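import Summits.CriticalPhenomena.PercolationContinuityZ3.Theorems.PercNearOneGluingNoHeavyLowerTailCSHPsiUnfold
import Summits.CriticalPhenomena.PercolationContinuityZ3.Theorems.PercNearOneGluingNoHeavyLowerTailCSHUnfoldMain
import Summits.CriticalPhenomena.PercolationContinuityZ3.Theorems.PercNearOneGluingNoHeavyLowerTailCSHPsiTools
import HarnessLib

/-!
# Pinned hierarchy (PIN-CSH) — LEMMA U_ψ FOR GENERAL `k`, assembled (pinned within-margin = pinned H-part + lower-level PINNED margins)

Support file (`--supports stmt-CriticalPhenomena-4575`), route task `nh-dp-fatminority` (line fat-minority-linear, gen 16); memo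
`run/shared/lean/prim/prim-nh-dp-fatminority/CSH-PSI-MEMO.md` §2 (Lemma U_ψ, proof of Theorem 1_ψ).  No definitions, no named facts, no sorries.
The pinned twin of prim-ineq-prove-1's `…CSHUnfoldMain.lean`.
* `PinCSH.within_unfold_pin` — the `{x↮Y}`-integral of the level-form margin (pinned decoy list) of the WORLD rows (`Cov_{w^ω}(g(C_x), 1{x↔u})` at a
  vertex, `Cov_{w^ω}(g(C_x), 1_{pinEv o 𝓗 x})` at the label; verbatim the integrand of `hW` of Lemma T_ψ `PinCSH.pMargin_nonneg_of_within`) EQUALS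
  `∫_{x↮Y} [Cov_{w^ω}(g(C_x), 1{o ↔ S}·1{C_o ∈ 𝓗}) − p·Cov_{w^ω}(g(C_x), 1{v ↔ S})] dμ_w + (psubT(o) − p·subT(v))`, `S = {x} ∪ D` (the first term in
  the shape of Lemma H_ψ `PinCSH.hpart_nonneg_pin`; `PinCSH.psubT` at the label, the pure `CSH.subT` at `v`).  Ingredients: the pointwise CLAIM with a
  pinned row `PinCSH.slForm_prel_jn`, `PinCSH.sum_wcov_unfoldT_pin` at the label and the pure `CSH.sum_wcov_unfoldT` at `v` (the `v`-row of the pinned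
  list unfolds as the pure one: `PinCSH.unfoldT_prel_of_ne`, `PinCSH.unfoldT_pDecoyList_of_ne`).
* `PinCSH.psubT_comb_nonneg` — `psubT(o) − p_ψ·subT(v) = Σ_j μ(E_j)⁻¹ · pMargin w o 𝓗 d_j Y_j D_{>j} v Φ̃_j ≥ 0` given the lower-level PINNED margins
  (the induction hypothesis), `p_ψ = PinCSH.pObsConst w o 𝓗 v ({x} ∪ Y ∪ D)`; `PinCSH.within_nonneg_of_hpart_pin` — the within-margin is `≥ 0` given
  the lower levels and `Hpart_ψ ≥ 0`.
[cite: VandenbergHaggstromKahn2005, §2.1 Lemma 2.4 (p. 10); §1 display (10) (pp. 7–8) — corollaries] [cite: KozmaNitzan2024, Question 7 (p. 36)]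
-/

noncomputable section
noncomputable section

namespace Summit.CriticalPhenomena.PercolationContinuityZ3.Theorems

open MeasureTheory Set Literature.Probability.LatticeModels Literature.Probability.Percolation
open scoped Classical
open BHK2006 DecisionTree HullPort CSH

namespace PinCSH

variable {V : Type*}

/-! ### Small dictionary -/

/-- The pinned world row function at the owner's singleton source set, read on a configuration `ζ`: `1_{pinEv o 𝓗 x}(ζ)` at the label,
`1{x ↔ u}(ζ)` at a vertex. [folklore] -/
theorem jn_prel_singleton_eq_ite (o : V) (𝓗 : Set (Set (Sym2 V))) (x u : V) (ζ : Set (Sym2 V)) :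
    jn (prel (openGraph ζ).Reachable (fun u => (openGraph ζ).Reachable u o ∧ openEdgeCluster ζ u ∈ 𝓗) o) {x} u =
      (if u = o then ind (pinEv o 𝓗 x) ζ else ind (openConn x u : Set (BondConfig V)) ζ) := by
  rw [jn_prel_singleton]
  by_cases hu : u = o
  · rw [if_pos hu, if_pos hu]; rfl
  · rw [if_neg hu, if_neg hu, chi_reachable_eq_ind]

/-- **The pinned set indicator `J^ψ_S` read on a configuration**: `1{∃ s ∈ S, s ↔ o ∧ C_s ∈ 𝓗}(ζ) = 1{o ↔ S}(ζ)·1{C_o(ζ) ∈ 𝓗}` (joined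
vertices have the same edge cluster). [folklore] -/
theorem jn_prel_label_eq_ind (o : V) (𝓗 : Set (Set (Sym2 V))) (S : Finset V) (ζ : Set (Sym2 V)) :
    jn (prel (openGraph ζ).Reachable (fun u => (openGraph ζ).Reachable u o ∧ openEdgeCluster ζ u ∈ 𝓗) o) (↑S : Set V) o =
      ind ((⋃ t ∈ S, (openConn o t : Set (BondConfig V))) ∩ {η | openEdgeCluster η o ∈ 𝓗}) ζ := by
  rw [jn_prel_label]
  have key : (∃ s ∈ (↑S : Set V), (openGraph ζ).Reachable s o ∧ openEdgeCluster ζ s ∈ 𝓗) ↔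
      ζ ∈ (⋃ t ∈ S, (openConn o t : Set (BondConfig V))) ∩ {η | openEdgeCluster η o ∈ 𝓗} := by
    simp only [Set.mem_inter_iff, Set.mem_iUnion, Finset.mem_coe, exists_prop, Set.mem_setOf_eq]
    constructor
    · rintro ⟨s, hs, hso, hsH⟩
      exact ⟨⟨s, hs, hso.symm⟩, (attachSet_openEdgeCluster_eq_of_reachable hso) ▸ hsH⟩
    · rintro ⟨⟨s, hs, hos⟩, hoH⟩
      exact ⟨s, hs, SimpleGraph.Reachable.symm hos, (attachSet_openEdgeCluster_eq_of_reachable (SimpleGraph.Reachable.symm hos)).symm ▸ hoH⟩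
  by_cases h : ζ ∈ (⋃ t ∈ S, (openConn o t : Set (BondConfig V))) ∩ {η | openEdgeCluster η o ∈ 𝓗}
  · rw [if_pos (key.2 h), ind_of_mem h]
  · rw [if_neg (fun h' => h (key.1 h')), ind_of_not_mem h]

variable [Fintype V]

/-! ### The main identity -/

/-- **LEMMA U_ψ FOR GENERAL `k`** (memo CSH-PSI-MEMO §2, assembled): the `{x↮Y}`-integral of the margin (pinned decoy list) of the world rows —
`Cov_{w^ω}(g(C_x), 1{x↔u})` at a vertex `u`, `Cov_{w^ω}(g(C_x), 1_{pinEv o 𝓗 x})` at the label — equals the pinned H-part (world covariances with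
`1{o ↔ {x}∪D}·1{C_o ∈ 𝓗}` and `1{v ↔ {x}∪D}`) plus `psubT(o) − p·subT(v)`.
(transcription of the memo prim-nh-dp-fatminority CSH-PSI-MEMO.md §2 Lemma U_ψ)
[cite: VandenbergHaggstromKahn2005, §2.1 Lemma 2.4 (p. 10); §1 display (10) (pp. 7–8) — corollaries] -/
theorem within_unfold_pin (w : Sym2 V → unitInterval) (hw : ∀ e, 0 < w e ∧ w e < 1) (o : V) (𝓗 : Set (Set (Sym2 V))) (x : V)
    (Y : Set V) (D : List V) (v : V) (hvo : v ≠ o)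
    (hnd : D.Nodup) (hD : ∀ d ∈ D, d ≠ x ∧ d ∉ Y ∧ d ≠ o ∧ d ≠ v) (g : Set (Sym2 V) → ℝ) (p : ℝ) :
    ∫ ω in {ω : BondConfig V | ∀ y ∈ Y, ¬ (openGraph ω).Reachable x y},
        cshMarg (pDecoyList w o 𝓗 (insert x Y) D) p o v
          (fun u => if u = o then
              (∫ η in pinEv o 𝓗 x, g (openEdgeCluster η x)
                  ∂(prodBernoulli fun e => if (∃ z ∈ e, ∃ y ∈ Y, (openGraph ω).Reachable y z)
                    then (0 : unitInterval) else w e)) -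
                (∫ η, g (openEdgeCluster η x)
                  ∂(prodBernoulli fun e => if (∃ z ∈ e, ∃ y ∈ Y, (openGraph ω).Reachable y z)
                    then (0 : unitInterval) else w e)) *
                (prodBernoulli fun e => if (∃ z ∈ e, ∃ y ∈ Y, (openGraph ω).Reachable y z)
                    then (0 : unitInterval) else w e).real (pinEv o 𝓗 x)
            else
              (∫ η in (openConn x u : Set (BondConfig V)), g (openEdgeCluster η x)
                  ∂(prodBernoulli fun e => if (∃ z ∈ e, ∃ y ∈ Y, (openGraph ω).Reachable y z)
                    then (0 : unitInterval) else w e)) -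
                (∫ η, g (openEdgeCluster η x)
                  ∂(prodBernoulli fun e => if (∃ z ∈ e, ∃ y ∈ Y, (openGraph ω).Reachable y z)
                    then (0 : unitInterval) else w e)) *
                (prodBernoulli fun e => if (∃ z ∈ e, ∃ y ∈ Y, (openGraph ω).Reachable y z)
                    then (0 : unitInterval) else w e).real (openConn x u : Set (BondConfig V)))
        ∂(prodBernoulli w) =
      (∫ ω in {ω : BondConfig V | ∀ y ∈ Y, ¬ (openGraph ω).Reachable x y},
        (((∫ η in (⋃ t ∈ insert x D.toFinset, openConn o t) ∩ {η | openEdgeCluster η o ∈ 𝓗}, g (openEdgeCluster η x)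
              ∂(prodBernoulli fun e => if (∃ z ∈ e, ∃ y ∈ Y, (openGraph ω).Reachable y z) then (0 : unitInterval) else w e)) -
            (prodBernoulli fun e => if (∃ z ∈ e, ∃ y ∈ Y, (openGraph ω).Reachable y z) then (0 : unitInterval) else w e).real
                ((⋃ t ∈ insert x D.toFinset, openConn o t) ∩ {η | openEdgeCluster η o ∈ 𝓗}) *
              (∫ η, g (openEdgeCluster η x)
                ∂(prodBernoulli fun e => if (∃ z ∈ e, ∃ y ∈ Y, (openGraph ω).Reachable y z) then (0 : unitInterval) else w e))) -
          p * ((∫ η in (⋃ t ∈ insert x D.toFinset, openConn v t), g (openEdgeCluster η x)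
              ∂(prodBernoulli fun e => if (∃ z ∈ e, ∃ y ∈ Y, (openGraph ω).Reachable y z) then (0 : unitInterval) else w e)) -
            (prodBernoulli fun e => if (∃ z ∈ e, ∃ y ∈ Y, (openGraph ω).Reachable y z) then (0 : unitInterval) else w e).real
                (⋃ t ∈ insert x D.toFinset, openConn v t) *
              (∫ η, g (openEdgeCluster η x)
                ∂(prodBernoulli fun e => if (∃ z ∈ e, ∃ y ∈ Y, (openGraph ω).Reachable y z) then (0 : unitInterval) else w e))))
        ∂(prodBernoulli w)) +
      (psubT w o 𝓗 x Y g {x} D - p * subT w x Y g v {x} D) := by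
  classical
  have hDev : {ω : BondConfig V | ∀ y ∈ Y, ¬ (openGraph ω).Reachable x y} = avoidEv x Y := rfl
  -- Step A: the integrand is a world covariance margin (sum vocabulary)
  rw [hDev, setIntegral_eq_sum_ind, setIntegral_eq_sum_ind]
  have hA : ∀ ω : Set (Sym2 V), cshMarg (pDecoyList w o 𝓗 (insert x Y) D) p o v
      (fun u => if u = o then
          (∫ η in pinEv o 𝓗 x, g (openEdgeCluster η x)
              ∂(prodBernoulli fun e => if (∃ z ∈ e, ∃ y ∈ Y, (openGraph ω).Reachable y z)
                then (0 : unitInterval) else w e)) -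
            (∫ η, g (openEdgeCluster η x)
              ∂(prodBernoulli fun e => if (∃ z ∈ e, ∃ y ∈ Y, (openGraph ω).Reachable y z)
                then (0 : unitInterval) else w e)) *
            (prodBernoulli fun e => if (∃ z ∈ e, ∃ y ∈ Y, (openGraph ω).Reachable y z)
                then (0 : unitInterval) else w e).real (pinEv o 𝓗 x)
        else
          (∫ η in (openConn x u : Set (BondConfig V)), g (openEdgeCluster η x)
              ∂(prodBernoulli fun e => if (∃ z ∈ e, ∃ y ∈ Y, (openGraph ω).Reachable y z)
                then (0 : unitInterval) else w e)) -
            (∫ η, g (openEdgeCluster η x)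
              ∂(prodBernoulli fun e => if (∃ z ∈ e, ∃ y ∈ Y, (openGraph ω).Reachable y z)
                then (0 : unitInterval) else w e)) *
            (prodBernoulli fun e => if (∃ z ∈ e, ∃ y ∈ Y, (openGraph ω).Reachable y z)
                then (0 : unitInterval) else w e).real (openConn x u : Set (BondConfig V))) =
      cshMarg (pDecoyList w o 𝓗 (insert x Y) D) p o v
        (fun u => if u = o then wcovOff (fun e => (w e : ℝ)) Y (fun β => g (openEdgeCluster β x)) (ind (pinEv o 𝓗 x)) ω
          else wcovOff (fun e => (w e : ℝ)) Y (fun β => g (openEdgeCluster β x)) (ind (openConn x u : Set (BondConfig V))) ω) := by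
    intro ω
    refine congrArg (cshMarg (pDecoyList w o 𝓗 (insert x Y) D) p o v) (funext fun u => ?_)
    by_cases hu : u = o
    · rw [if_pos hu, if_pos hu]
      convert world_cov_eq_wcovOff w Y ω (fun β => g (openEdgeCluster β x)) (pinEv o 𝓗 x) using 12
    · rw [if_neg hu, if_neg hu]
      convert world_cov_eq_wcovOff w Y ω (fun β => g (openEdgeCluster β x)) (openConn x u : Set (BondConfig V)) using 12
  simp only [hA]
  set ŵ : Sym2 V → ℝ := fun e => (w e : ℝ) with hŵ
  have hm : ∑ ω, weight ŵ ω = 1 := by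
    have h1 := integral_prodBernoulli_eq_sum w fun _ => (1 : ℝ)
    simp only [integral_const, probReal_univ, smul_eq_mul, mul_one] at h1
    exact h1.symm
  set L := pDecoyList w o 𝓗 (insert x Y) D with hLdef
  set G : Set (Sym2 V) → ℝ := fun β => g (openEdgeCluster β x) with hG
  have hL' : L = pDecoyList w o 𝓗 ({x} ∪ Y) D := by rw [hLdef, ← Set.insert_eq]
  have hdecs : {d : V | d ∈ L.map Prod.fst} = {d | d ∈ D} := by rw [hLdef, map_fst_pDecoyList]
  have hLo : ∀ dc ∈ L, dc.1 ≠ o := fun dc hdc => (hD dc.1 (mem_pDecoyList w o 𝓗 _ D dc hdc)).2.2.1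
  have hDo0 : ∀ d ∈ D, d ≠ o := fun d hd => (hD d hd).2.2.1
  set Sset : Set V := {x} ∪ {d | d ∈ D} with hSset
  have hSfin : (↑(insert x D.toFinset) : Set V) = Sset := by ext u; simp [hSset]
  -- the pinned row relation of a configuration, its world test functions
  have hRs : ∀ (ζ : Set (Sym2 V)) (a b : V), (openGraph ζ).Reachable a b → (openGraph ζ).Reachable b a := fun _ _ _ h => h.symm
  have hRt : ∀ (ζ : Set (Sym2 V)) (a b c : V), (openGraph ζ).Reachable a b → (openGraph ζ).Reachable b c →
      (openGraph ζ).Reachable a c := fun _ _ _ _ h h' => h.trans h'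
  set Jf : V → Set (Sym2 V) → ℝ := fun u ζ =>
    jn (prel (openGraph ζ).Reachable (fun u => (openGraph ζ).Reachable u o ∧ openEdgeCluster ζ u ∈ 𝓗) o) Sset u with hJf
  set Tf : V → Set (Sym2 V) → ℝ := fun u ζ =>
    unfoldT (prel (openGraph ζ).Reachable (fun u => (openGraph ζ).Reachable u o ∧ openEdgeCluster ζ u ∈ 𝓗) o) {x} L u with hTf
  -- the world row as the pinned row function of the world configuration
  have hrow : ∀ ω, (fun u => if u = o then wcovOff ŵ Y G (ind (pinEv o 𝓗 x)) ω
        else wcovOff ŵ Y G (ind (openConn x u : Set (BondConfig V))) ω) =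
      fun u => wcovOff ŵ Y G (fun ζ =>
        jn (prel (openGraph ζ).Reachable (fun u => (openGraph ζ).Reachable u o ∧ openEdgeCluster ζ u ∈ 𝓗) o) {x} u) ω := by
    intro ω
    funext u
    simp only [jn_prel_singleton_eq_ite]
    by_cases hu : u = o
    · simp only [hu, if_true]
    · simp only [hu, if_false]
  -- Step B: pointwise unfolding of the margin of the world covariances
  have stepB : ∀ ω, cshMarg L p o v (fun u => if u = o then wcovOff ŵ Y G (ind (pinEv o 𝓗 x)) ω
        else wcovOff ŵ Y G (ind (openConn x u : Set (BondConfig V))) ω) =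
      wcovOff ŵ Y G (Jf o) ω - p * wcovOff ŵ Y G (Jf v) ω - wcovOff ŵ Y G (Tf o) ω + p * wcovOff ŵ Y G (Tf v) ω := by
    intro ω
    rw [hrow ω, cshMarg_eq_sum_single, wcovOff_finset_sum]
    have inner : (fun ζ => ∑ u, cshMarg L p o v (Pi.single u (1 : ℝ)) *
        jn (prel (openGraph ζ).Reachable (fun u => (openGraph ζ).Reachable u o ∧ openEdgeCluster ζ u ∈ 𝓗) o) {x} u) =
        fun ζ => (Jf o ζ - p * Jf v ζ) - (Tf o ζ - p * Tf v ζ) + (unfoldK L o - p * unfoldK L v) := by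
      funext ζ
      rw [← cshMarg_eq_sum_single L p o v
        (jn (prel (openGraph ζ).Reachable (fun u => (openGraph ζ).Reachable u o ∧ openEdgeCluster ζ u ∈ 𝓗) o) {x})]
      simp only [cshMarg, slForm_prel_jn (openGraph ζ).Reachable
        (fun u => (openGraph ζ).Reachable u o ∧ openEdgeCluster ζ u ∈ 𝓗) o (hRs ζ) (hRt ζ)
        (pinPred_closed ζ o 𝓗) (pinPred_exclusive ζ o 𝓗) L hLo {x}, hdecs, hJf, hTf, hSset]
      ring
    rw [inner, wcovOff_affine ŵ hm]
  -- Step C: sum over ω; the `unfoldT` parts are `−psubT(o)` and `−subT(v)`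
  have hDo : ∀ d ∈ D, d ∉ ({x} : Set V) ∧ d ∉ Y ∧ d ≠ o := fun d hd =>
    ⟨fun h => (hD d hd).1 (Set.mem_singleton_iff.1 h), (hD d hd).2.1, (hD d hd).2.2.1⟩
  have hDv : ∀ d ∈ D, d ∉ ({x} : Set V) ∧ d ∉ Y ∧ d ≠ v := fun d hd =>
    ⟨fun h => (hD d hd).1 (Set.mem_singleton_iff.1 h), (hD d hd).2.1, (hD d hd).2.2.2⟩
  have stepCo := sum_wcov_unfoldT_pin w hw o 𝓗 x Y g D {x} (Set.mem_singleton x) hnd hDo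
  have stepCv := sum_wcov_unfoldT w hw x Y g v D {x} (Set.mem_singleton x) hnd hDv
  rw [← hL'] at stepCo
  -- the `v`-row of the pinned list unfolds as the pure one
  have hTfv : Tf v = fun ζ => unfoldT (openGraph ζ).Reachable {x} (decoyList w ({x} ∪ Y) D) v := by
    funext ζ; rw [hTf]; dsimp only
    rw [unfoldT_prel_of_ne _ _ _ L hLo {x} hvo, hL', unfoldT_pDecoyList_of_ne _ w o 𝓗 D ({x} ∪ Y) {x} hDo0 v hvo]
  have e : ∀ ω, weight ŵ ω * (ind (avoidEv x Y) ω *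
      cshMarg L p o v (fun u => if u = o then wcovOff ŵ Y G (ind (pinEv o 𝓗 x)) ω
        else wcovOff ŵ Y G (ind (openConn x u : Set (BondConfig V))) ω)) =
      weight ŵ ω * (ind (avoidEv x Y) ω * (wcovOff ŵ Y G (Jf o) ω - p * wcovOff ŵ Y G (Jf v) ω)) -
        weight ŵ ω * (ind (avoidEv x Y) ω * wcovOff ŵ Y G (Tf o) ω) +
        p * (weight ŵ ω * (ind (avoidEv x Y) ω * wcovOff ŵ Y G (Tf v) ω)) := by
    intro ω; rw [stepB ω]; ring
  rw [Finset.sum_congr rfl (fun ω _ => e ω), Finset.sum_add_distrib, Finset.sum_sub_distrib, ← Finset.mul_sum, hTfv]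
  change (∑ ω, weight ŵ ω * (ind (avoidEv x Y) ω * (wcovOff ŵ Y G (Jf o) ω - p * wcovOff ŵ Y G (Jf v) ω))) -
      (∑ ω, weight ŵ ω * (ind (avoidEv x Y) ω * wcovOff ŵ Y G
        (fun ζ => unfoldT (prel (openGraph ζ).Reachable (fun u => (openGraph ζ).Reachable u o ∧ openEdgeCluster ζ u ∈ 𝓗) o)
          {x} L o) ω)) +
      p * (∑ ω, weight ŵ ω * (ind (avoidEv x Y) ω * wcovOff ŵ Y G
        (fun ζ => unfoldT (openGraph ζ).Reachable {x} (decoyList w ({x} ∪ Y) D) v) ω)) = _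
  rw [stepCo, stepCv]
  -- Step D: the H-part back in measure form
  have hJo : Jf o = ind ((⋃ t ∈ insert x D.toFinset, (openConn o t : Set (BondConfig V))) ∩ {η | openEdgeCluster η o ∈ 𝓗}) := by
    funext ζ; rw [hJf]; dsimp only; rw [← hSfin, jn_prel_label_eq_ind]
  have hJv : Jf v = ind (⋃ t ∈ insert x D.toFinset, (openConn v t : Set (BondConfig V))) := by
    funext ζ; rw [hJf]; dsimp only; rw [jn_prel_of_ne _ _ _ _ hvo, jn_reachable_eq_ind, ← setOf_exists_reachable_eq_iUnion, hSfin]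
  have eH : ∀ ω, weight ŵ ω * (ind (avoidEv x Y) ω * (wcovOff ŵ Y G (Jf o) ω - p * wcovOff ŵ Y G (Jf v) ω)) =
      weight ŵ ω * (ind (avoidEv x Y) ω *
        (wcovOff ŵ Y G (ind ((⋃ t ∈ insert x D.toFinset, (openConn o t : Set (BondConfig V))) ∩
            {η | openEdgeCluster η o ∈ 𝓗})) ω -
          p * wcovOff ŵ Y G (ind (⋃ t ∈ insert x D.toFinset, (openConn v t : Set (BondConfig V)))) ω)) := by
    intro ω; rw [hJo, hJv]
  rw [Finset.sum_congr rfl (fun ω _ => eH ω)]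
  have eM : ∀ ω, weight ŵ ω * (ind (avoidEv x Y) ω *
      (((∫ η in (⋃ t ∈ insert x D.toFinset, openConn o t) ∩ {η | openEdgeCluster η o ∈ 𝓗}, g (openEdgeCluster η x)
            ∂(prodBernoulli fun e => if (∃ z ∈ e, ∃ y ∈ Y, (openGraph ω).Reachable y z) then (0 : unitInterval) else w e)) -
          (prodBernoulli fun e => if (∃ z ∈ e, ∃ y ∈ Y, (openGraph ω).Reachable y z) then (0 : unitInterval) else w e).real
              ((⋃ t ∈ insert x D.toFinset, openConn o t) ∩ {η | openEdgeCluster η o ∈ 𝓗}) *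
            (∫ η, g (openEdgeCluster η x)
              ∂(prodBernoulli fun e => if (∃ z ∈ e, ∃ y ∈ Y, (openGraph ω).Reachable y z) then (0 : unitInterval) else w e))) -
        p * ((∫ η in (⋃ t ∈ insert x D.toFinset, openConn v t), g (openEdgeCluster η x)
            ∂(prodBernoulli fun e => if (∃ z ∈ e, ∃ y ∈ Y, (openGraph ω).Reachable y z) then (0 : unitInterval) else w e)) -
          (prodBernoulli fun e => if (∃ z ∈ e, ∃ y ∈ Y, (openGraph ω).Reachable y z) then (0 : unitInterval) else w e).real
              (⋃ t ∈ insert x D.toFinset, openConn v t) *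
            (∫ η, g (openEdgeCluster η x)
              ∂(prodBernoulli fun e => if (∃ z ∈ e, ∃ y ∈ Y, (openGraph ω).Reachable y z) then (0 : unitInterval) else w e))))) =
      weight ŵ ω * (ind (avoidEv x Y) ω *
        (wcovOff ŵ Y G (ind ((⋃ t ∈ insert x D.toFinset, (openConn o t : Set (BondConfig V))) ∩
            {η | openEdgeCluster η o ∈ 𝓗})) ω -
          p * wcovOff ŵ Y G (ind (⋃ t ∈ insert x D.toFinset, (openConn v t : Set (BondConfig V)))) ω)) := by
    intro ω
    -- `CSH.world_cov_eq_wcovOff` in this file's instance environment (the decidability instances inside the world weights differ; `convert`)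
    have e1 : (∫ η in (⋃ t ∈ insert x D.toFinset, openConn o t) ∩ {η | openEdgeCluster η o ∈ 𝓗}, G η
          ∂(prodBernoulli fun e => if (∃ z ∈ e, ∃ y ∈ Y, (openGraph ω).Reachable y z) then (0 : unitInterval) else w e)) -
        (∫ η, G η ∂(prodBernoulli fun e => if (∃ z ∈ e, ∃ y ∈ Y, (openGraph ω).Reachable y z) then (0 : unitInterval) else w e)) *
          (prodBernoulli fun e => if (∃ z ∈ e, ∃ y ∈ Y, (openGraph ω).Reachable y z) then (0 : unitInterval) else w e).real
            ((⋃ t ∈ insert x D.toFinset, openConn o t) ∩ {η | openEdgeCluster η o ∈ 𝓗}) =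
        wcovOff ŵ Y G (ind ((⋃ t ∈ insert x D.toFinset, (openConn o t : Set (BondConfig V))) ∩ {η | openEdgeCluster η o ∈ 𝓗})) ω := by
      convert world_cov_eq_wcovOff w Y ω G ((⋃ t ∈ insert x D.toFinset, (openConn o t : Set (BondConfig V))) ∩
        {η | openEdgeCluster η o ∈ 𝓗}) using 12
    have e2 : (∫ η in (⋃ t ∈ insert x D.toFinset, openConn v t), G η
          ∂(prodBernoulli fun e => if (∃ z ∈ e, ∃ y ∈ Y, (openGraph ω).Reachable y z) then (0 : unitInterval) else w e)) -
        (∫ η, G η ∂(prodBernoulli fun e => if (∃ z ∈ e, ∃ y ∈ Y, (openGraph ω).Reachable y z) then (0 : unitInterval) else w e)) *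
          (prodBernoulli fun e => if (∃ z ∈ e, ∃ y ∈ Y, (openGraph ω).Reachable y z) then (0 : unitInterval) else w e).real
            (⋃ t ∈ insert x D.toFinset, openConn v t) =
        wcovOff ŵ Y G (ind (⋃ t ∈ insert x D.toFinset, (openConn v t : Set (BondConfig V)))) ω := by
      convert world_cov_eq_wcovOff w Y ω G (⋃ t ∈ insert x D.toFinset, (openConn v t : Set (BondConfig V))) using 12
    rw [← e1, ← e2]
    ring
  rw [Finset.sum_congr rfl (fun ω _ => eM ω)]
  ring

/-! ### The lower-level terms are nonnegative given the lower levels -/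

/-- **`psubT(o) − p_ψ·subT(v) ≥ 0` from the lower PINNED levels** (memo §2, proof of Theorem 1_ψ: "the sub-systems are PIN-CSH of lower level with
the same label `o` and test `ψ`"): along the splittings `D₀ = pre ++ rest`, with the source set `S = {x} ∪ pre`,
`psubT_S(rest)(o) − p_ψ·subT_S(rest)(v) = Σ_{d ∈ rest} μ(E_d)⁻¹ · pMargin w o 𝓗 d ({x}∪Y∪pre_d) rest_{>d} v Φ̃_d`, each term nonnegative when the
lower-level pinned margins at the monotone nonnegative functionals `Φ̃_d` are (hypothesis `hIH`) and `p_ψ = pObsConst w o 𝓗 v ({x} ∪ Y ∪ D₀)`.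
(transcription of the memo prim-nh-dp-fatminority CSH-PSI-MEMO.md §2, proof of Theorem 1_ψ) [cite: KozmaNitzan2024, Question 7 (p. 36)] -/
theorem psubT_comb_nonneg (w : Sym2 V → unitInterval) (o : V) (𝓗 : Set (Set (Sym2 V))) (x : V) (Y : Set V) (D₀ : List V) (v : V)
    (hvo : v ≠ o) (hD₀o : ∀ d ∈ D₀, d ≠ o) {g : Set (Sym2 V) → ℝ} (hg : Monotone g)
    (hIH : ∀ (pre : List V) (d : V) (ds' : List V), D₀ = pre ++ d :: ds' →
      ∀ h : Set (Sym2 V) → ℝ, Monotone h → (∀ C, 0 ≤ h C) →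
        0 ≤ pMargin w o 𝓗 d (insert x Y ∪ {e | e ∈ pre}) ds' v h) :
    ∀ (rest pre : List V), D₀ = pre ++ rest →
      0 ≤ psubT w o 𝓗 x Y g ({x} ∪ {e | e ∈ pre}) rest -
        pObsConst w o 𝓗 v (insert x Y ∪ {d | d ∈ D₀}) * subT w x Y g v ({x} ∪ {e | e ∈ pre}) rest := by
  intro rest
  induction rest with
  | nil => intro pre _; simp [subT]
  | cons d ds ih =>
    intro pre hsplit
    set A : Set V := {x} ∪ {e | e ∈ pre} ∪ Y with hA
    have hA' : A = insert x Y ∪ {e | e ∈ pre} := by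
      ext u; simp only [hA, Set.mem_union, Set.mem_singleton_iff, Set.mem_setOf_eq, Set.mem_insert_iff]; tauto
    have hset : insert d A ∪ {e | e ∈ ds} = insert x Y ∪ {e | e ∈ D₀} := by
      ext u
      simp only [hA, hsplit, Set.mem_union, Set.mem_insert_iff, Set.mem_singleton_iff, Set.mem_setOf_eq, List.mem_append,
        List.mem_cons]
      tauto
    have hdso : ∀ d' ∈ ds, d' ≠ o := fun d' hd' => hD₀o d' (by rw [hsplit]; exact List.mem_append_right pre (List.mem_cons_of_mem d hd'))
    -- the `v`-row of the pinned sub-system list is the pure one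
    have hvrow : slForm (pDecoyList w o 𝓗 (insert d A) ds) (pCovD w o 𝓗 d A (phiT w x Y g d)) v =
        slForm (decoyList w (insert d A) ds) (covD w d A (phiT w x Y g d)) v :=
      slForm_pDecoyList_of_ne w o 𝓗 ds (insert d A) _ _ (fun w' hw' => pCovD_of_ne w o 𝓗 d A _ hw') hdso v hvo
    -- the head term is `μ(E)⁻¹ · pMargin w o 𝓗 d A' ds v Φ̃_d ≥ 0`
    have hmargin : slForm (pDecoyList w o 𝓗 (insert d A) ds) (pCovD w o 𝓗 d A (phiT w x Y g d)) o -
        pObsConst w o 𝓗 v (insert x Y ∪ {e | e ∈ D₀}) * slForm (decoyList w (insert d A) ds) (covD w d A (phiT w x Y g d)) v =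
        pMargin w o 𝓗 d (insert x Y ∪ {e | e ∈ pre}) ds v (phiT w x Y g d) := by
      rw [← hvrow, ← hset, ← hA']; rfl
    have hhead : 0 ≤ pMargin w o 𝓗 d (insert x Y ∪ {e | e ∈ pre}) ds v (phiT w x Y g d) :=
      hIH pre d ds hsplit (phiT w x Y g d) (phiT_mono w x Y hg d) (fun K => phiFun_nonneg w x Y hg _)
    have hinv : 0 ≤ ((prodBernoulli w).real (avoidEv d A))⁻¹ := inv_nonneg.2 measureReal_nonneg
    -- the tail by induction with `pre ++ [d]`
    have htail := ih (pre ++ [d]) (by rw [hsplit]; simp)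
    have hS' : ({x} ∪ {e | e ∈ pre ++ [d]} : Set V) = insert d ({x} ∪ {e | e ∈ pre}) := by
      ext u
      simp only [Set.mem_union, Set.mem_singleton_iff, Set.mem_setOf_eq, List.mem_append, List.mem_singleton, Set.mem_insert_iff]
      tauto
    rw [hS'] at htail
    have hSY : ({x} ∪ {e | e ∈ pre} : Set V) ∪ Y = A := rfl
    simp only [subT, psubT, hSY]
    have key : ((prodBernoulli w).real (avoidEv d A))⁻¹ *
          slForm (pDecoyList w o 𝓗 (insert d A) ds) (pCovD w o 𝓗 d A (phiT w x Y g d)) o +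
        psubT w o 𝓗 x Y g (insert d ({x} ∪ {e | e ∈ pre})) ds -
        pObsConst w o 𝓗 v (insert x Y ∪ {d | d ∈ D₀}) *
          (((prodBernoulli w).real (avoidEv d A))⁻¹ *
              slForm (decoyList w (insert d A) ds) (covD w d A (phiT w x Y g d)) v +
            subT w x Y g v (insert d ({x} ∪ {e | e ∈ pre})) ds) =
        ((prodBernoulli w).real (avoidEv d A))⁻¹ * pMargin w o 𝓗 d (insert x Y ∪ {e | e ∈ pre}) ds v (phiT w x Y g d) +
          (psubT w o 𝓗 x Y g (insert d ({x} ∪ {e | e ∈ pre})) ds -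
            pObsConst w o 𝓗 v (insert x Y ∪ {d | d ∈ D₀}) * subT w x Y g v (insert d ({x} ∪ {e | e ∈ pre})) ds) := by
      rw [← hmargin]; ring
    rw [key]
    exact add_nonneg (mul_nonneg hinv hhead) htail

/-- **The pinned within-margin is nonnegative given the lower pinned levels and the pinned H-part** — the hypothesis `hW` of Lemma T_ψ
`PinCSH.pMargin_nonneg_of_within` modulo Lemma H_ψ: for non-degenerate weights, distinct data (`o ≠ v`), `g` monotone `≥ 0`,
`0 ≤ Hpart_ψ` (`hHP`, the conclusion of `PinCSH.hpart_nonneg_pin` at `S = {x} ∪ D`, `p_ψ = pObsConst w o 𝓗 v ({x}∪Y∪D)`) and the lower-level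
pinned margins nonnegative (`hIH`) imply `0 ≤ ∫_{x↮Y} Marg[pinned world rows] dμ_w`.
(transcription of the memo prim-nh-dp-fatminority CSH-PSI-MEMO.md §2, proof of Theorem 1_ψ) [cite: KozmaNitzan2024, Question 7 (p. 36)] -/
theorem within_nonneg_of_hpart_pin (w : Sym2 V → unitInterval) (hw : ∀ e, 0 < w e ∧ w e < 1) (o : V) (𝓗 : Set (Set (Sym2 V))) (x : V)
    (Y : Set V) (D : List V) (v : V) (hvo : v ≠ o) (hnd : D.Nodup) (hD : ∀ d ∈ D, d ≠ x ∧ d ∉ Y ∧ d ≠ o ∧ d ≠ v)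
    {g : Set (Sym2 V) → ℝ} (hg : Monotone g)
    (hIH : ∀ (pre : List V) (d : V) (ds' : List V), D = pre ++ d :: ds' →
      ∀ h : Set (Sym2 V) → ℝ, Monotone h → (∀ C, 0 ≤ h C) →
        0 ≤ pMargin w o 𝓗 d (insert x Y ∪ {e | e ∈ pre}) ds' v h)
    (hHP : 0 ≤ ∫ ω in {ω : BondConfig V | ∀ y ∈ Y, ¬ (openGraph ω).Reachable x y},
        (((∫ η in (⋃ t ∈ insert x D.toFinset, openConn o t) ∩ {η | openEdgeCluster η o ∈ 𝓗}, g (openEdgeCluster η x)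
              ∂(prodBernoulli fun e => if (∃ z ∈ e, ∃ y ∈ Y, (openGraph ω).Reachable y z) then (0 : unitInterval) else w e)) -
            (prodBernoulli fun e => if (∃ z ∈ e, ∃ y ∈ Y, (openGraph ω).Reachable y z) then (0 : unitInterval) else w e).real
                ((⋃ t ∈ insert x D.toFinset, openConn o t) ∩ {η | openEdgeCluster η o ∈ 𝓗}) *
              (∫ η, g (openEdgeCluster η x)
                ∂(prodBernoulli fun e => if (∃ z ∈ e, ∃ y ∈ Y, (openGraph ω).Reachable y z) then (0 : unitInterval) else w e))) -
          pObsConst w o 𝓗 v (insert x Y ∪ {d | d ∈ D}) *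
            ((∫ η in (⋃ t ∈ insert x D.toFinset, openConn v t), g (openEdgeCluster η x)
              ∂(prodBernoulli fun e => if (∃ z ∈ e, ∃ y ∈ Y, (openGraph ω).Reachable y z) then (0 : unitInterval) else w e)) -
            (prodBernoulli fun e => if (∃ z ∈ e, ∃ y ∈ Y, (openGraph ω).Reachable y z) then (0 : unitInterval) else w e).real
                (⋃ t ∈ insert x D.toFinset, openConn v t) *
              (∫ η, g (openEdgeCluster η x)
                ∂(prodBernoulli fun e => if (∃ z ∈ e, ∃ y ∈ Y, (openGraph ω).Reachable y z) then (0 : unitInterval) else w e))))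
        ∂(prodBernoulli w)) :
    0 ≤ ∫ ω in {ω : BondConfig V | ∀ y ∈ Y, ¬ (openGraph ω).Reachable x y},
        cshMarg (pDecoyList w o 𝓗 (insert x Y) D) (pObsConst w o 𝓗 v (insert x Y ∪ {d | d ∈ D})) o v
          (fun u => if u = o then
              (∫ η in pinEv o 𝓗 x, g (openEdgeCluster η x)
                  ∂(prodBernoulli fun e => if (∃ z ∈ e, ∃ y ∈ Y, (openGraph ω).Reachable y z)
                    then (0 : unitInterval) else w e)) -
                (∫ η, g (openEdgeCluster η x)
                  ∂(prodBernoulli fun e => if (∃ z ∈ e, ∃ y ∈ Y, (openGraph ω).Reachable y z)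
                    then (0 : unitInterval) else w e)) *
                (prodBernoulli fun e => if (∃ z ∈ e, ∃ y ∈ Y, (openGraph ω).Reachable y z)
                    then (0 : unitInterval) else w e).real (pinEv o 𝓗 x)
            else
              (∫ η in (openConn x u : Set (BondConfig V)), g (openEdgeCluster η x)
                  ∂(prodBernoulli fun e => if (∃ z ∈ e, ∃ y ∈ Y, (openGraph ω).Reachable y z)
                    then (0 : unitInterval) else w e)) -
                (∫ η, g (openEdgeCluster η x)
                  ∂(prodBernoulli fun e => if (∃ z ∈ e, ∃ y ∈ Y, (openGraph ω).Reachable y z)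
                    then (0 : unitInterval) else w e)) *
                (prodBernoulli fun e => if (∃ z ∈ e, ∃ y ∈ Y, (openGraph ω).Reachable y z)
                    then (0 : unitInterval) else w e).real (openConn x u : Set (BondConfig V)))
        ∂(prodBernoulli w) := by
  rw [within_unfold_pin w hw o 𝓗 x Y D v hvo hnd hD g]
  have hsub := psubT_comb_nonneg w o 𝓗 x Y D v hvo (fun d hd => (hD d hd).2.2.1) hg hIH D [] (by simp)
  have hS0 : ({x} ∪ {e | e ∈ ([] : List V)} : Set V) = {x} := by ext u; simp
  rw [hS0] at hsub
  exact add_nonneg hHP hsub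

end PinCSH

end Summit.CriticalPhenomena.PercolationContinuityZ3.Theorems

end
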